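import Literature.MathematicalPhysics.QuantumFieldTheory.Balaban1983to89.B9Eq3152GtildeThirdWordSupRowClosed

/-!
# `Balaban1983to89.B9Eq3152GtildeThirdWordTwoSided` — T. Bałaban, *Propagators for lattice gauge theories in a background field*, Commun. Math. Phys. **99**
# (1985) 389–434 [Balaban1985BackgroundPropagators] (3.152) p. 426 *«RD\*G₁ = RG′D\*, and G₁DR = DG′R»*, (3.150)∕(3.153) p. 426 (*«𝔊 = G₁ − G₁DRD\*G₁ −
# DG′RG′D\* + … = G₁ − G₁DRD\*G₁ − G₁Q\*(QG₁Q\*)⁻¹QG₁»*), p. 426 *«The formulas (3.147), (3.153) permit us to reduce properties of the operators 𝔓, 𝔊 to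
# the corresponding properties of the operators G′, (Q′G′²Q′\*)⁻¹, G₁, (QG₁Q\*)⁻¹»*, Thm 3.13 p. 426: **BOTH HALVES OF (3.152) FOR PRINT's `G̃_k = Δ̃_{a,k}(U)⁻¹`
# AND THE THIRD WORD OF `𝔊̃_k` AS A PURE `G′_k`-WORD — `R_kD*_UG̃_k = R_kG′_kD*_U` (the Hilbert adjoint of this lineage's (T4E) §1 `G̃_kD_UR_k = D_UG′_kR_k`) and
# hence `G̃_kD_UR_kD*_UG̃_k = D_UG′_kR_kG′_kD*_U`** — the algebraic step that puts the GRADIENT member of [Balaban1985Variational] (117) for the third word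
# (STOREY H of the NE9 owner's ruling R-ne9p1-g97-3) on the SITE propagator `G′_k(U)` of Thm 3.1 alone: `∇_U(third word) = [∇_UD_UG′_k] ∘ R_k ∘ [G′_kD*_U]`,
# to be fed by Thm 3.1's Hölder members (3.43)₂ ∕ (3.44) (successor files); NE9 crux-team LEAF PROVER 01, gen 92

statement-level skeleton of published theorems with citation tags; proofs where landed; nothing here is a claim about the Yang–Mills mass gap

CITATION HEADER (lean-in-tree rule).  Audit cell `pub-balaban`, sub-cell `t4`, BINDER row NE9; filed by NE9 crux-team LEAF PROVER 01 (`b2b-balaban-t4-ne9-formalise-leaf-01`,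
gen 92; bears_on: R4/N22).  Source READ first-hand this generation (`paper:balaban1985-cmp99-background-propagators`, journal page = PDF page + 388): p. 426 (3.151)–(3.153)
(«A𝒢̃D*J = … = RG′D*J, hence (3.151) gives RD*G₁ = RG′D*, and G₁DR = DG′R»), p. 425 (3.147), p. 394 (3.21)–(3.25), p. 397 Thm 3.1 (3.42)–(3.44), p. 398 («the choice of
derivatives ∇_U, ∇*_U is conventional, we may always replace ∇_U by ∇*_U, and vice versa, in arbitrary place and combination»).  COMPOSED BY NAME, nothing restated:
the NE9 owner's (T4E) `B9Eq3152GtildeThirdWordSupRowClosed.G1LatticeKPi_covDerivL2K_RofUk` (the right half `G̃_kD_UR_k = D_UG′_kR_k`), the symmetries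
`B9Eq326OperatorTower.RofUk_isSymmetric` ((3.21): `R_k` an orthogonal projection), `B9Eq3124GaugeModes.greenK_isSymmetric` at `B9Eq3119DeltaPiTower.laplaceAkPi_isSymmetric`
(`G̃_k`) and at `B9Eq324DeltaPrimeATower.laplacePrimeAk_isSymmetric` (`G′_k`), and `B11Eq103H1Complex.adjoint_covDerivL2K` (`D*_U = D_U†`) at
`B9Eq310HessianHermitian.adTransportW_adjoint` (unitary background, tracial norming).

WHAT IS PROVED (sorry-free; proof lane — 0 `def`; [folklore] Hilbert-space algebra).
* §1 **`RofUk_covDivL2K_G1LatticeKPi`** — THE LEFT HALF OF (3.152) for print's `G̃_k`: `R_k(D*_U(G̃_kf)) = R_k(G′_k(D*_Uf))` for every bond field `f` — the adjoint of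
  (T4E) §1 read through `⟪·, s⟫` for every gauge parameter `s` (`R_k`, `G̃_k`, `G′_k` symmetric, `D*_U = D_U†`), `ext_inner_right`.
* §2 **`thirdWord_G1LatticeKPi_eq`** — `G̃_k(D_U(R_k(D*_U(G̃_kf)))) = D_U(G′_k(R_k(G′_k(D*_Uf))))`: (T4E) §1 at `s := D*_U(G̃_kf)`, then §1 — print's third word
  `DG′RG′D*` of (3.150)∕(3.153); **`thirdWord_G1LatticeKPi_eq_slice`** — the same read on the plain bond functions (`WL2.equiv`), the form the row files consume.
HONEST SCOPE.  Two identities of linear maps on the cell's finite-dimensional `L²` carriers; NO estimate; the Hölder members (3.43)₂∕(3.44) of Thm 3.1 for `G′_k(U)`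
that the gradient row of the third word needs are NOT here (successor files display ∕ supply them); `hpos′`, `hposπ` and the Q-regularity letters stay
DISPLAYED; nothing of [B9] (3.152)–(3.153) ∕ Thm 3.1 ∕ Thm 3.13 is asserted beyond these two identities on the MODEL; «NE9 ⇐ the named binders»; NE9 NOT PRINTED ∕
NOT PROVED; row WALLED ON A MODEL (O-NE9-1; #5 UNRULED); spine PROVED 0∕9; rung (B)+1 on a finite T⁴ — NOT infinite volume, NOT mass gap, NOT BetaPertH, NOT Clay.
HONEST DEPENDENCY: continuum YM on T⁴ ⇐ BetaPertH ∧ nine spine estimates (0/9 proved); BetaPertH ⇐ (D1) ∧ (D4) ∧ CAP+tail; G-an2-4 gates asym, D1 and NE2/3/4.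
NEW file importing the BUILT (T4E) `B9Eq3152GtildeThirdWordSupRowClosed` only; nothing modified.  Net new unproved facts: 0.
-/

noncomputable section

set_option autoImplicit false

open scoped InnerProductSpace ComplexConjugate BigOperators

namespace Literature.MathematicalPhysics.QuantumFieldTheory.Balaban1983to89.B9Eq3152GtildeThirdWordTwoSided

open B4Sect5Torus (TSite)
open B9SectCLatticeCarrier (Bond)
open B9Eq311L2Pairing (WL2)
open B7Prop1Explicit (U1 Wcx boxVec)
open B11Eq103H1Complex (SiteL2K BondL2K covDerivL2K covDivL2K G1LatticeK adjoint_covDerivL2K)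
open B9Eq310HessianOperator (adTransportW hessOp)
open B9Eq310HessianHermitian (adTransportW_adjoint hessOp_isSymmetric_of_trace)
open B9Eq315QTorus (perCfg cornerSite)
open B9Eq315QTower (towerP UlevOf)
open B9Eq326OperatorTower (QprimeTowerW QkW RofUk RofUk_isSymmetric)
open B9Eq324DeltaPrimeATower (laplacePrimeAk GpOfUk laplacePrimeAk_isSymmetric)
open B9Eq3119DeltaPiTower (piOfUk laplaceAkPi laplaceAkPi_isSymmetric)
open B9Eq3124GaugeModes (greenK_isSymmetric)
open B9Eq3152GtildeThirdWordSupRowClosed (G1LatticeKPi_covDerivL2K_RofUk)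

variable {d : ℕ} (L : ℕ) [NeZero L] (m : Fin d → ℕ) [∀ i, NeZero (m i)] (n : ℕ)
  {𝔸 : Type*} [NormedRing 𝔸] [NormedAlgebra ℂ 𝔸] [CompleteSpace 𝔸] [StarRing 𝔸] [StarModule ℂ 𝔸] [NormOneClass 𝔸]
  {W : Type*} [NormedAddCommGroup W] [InnerProductSpace ℂ W] [FiniteDimensional ℂ W] (φ : W ≃ₗ[ℂ] 𝔸) {c₀ c₁ : ℝ} [Fact (0 < c₀)] [Fact (0 < c₁)]
  (τ : 𝔸 →ₗ[ℂ] ℂ) (hτ₁ : ∀ X : 𝔸, τ (star X) = conj (τ X)) (hτ₂ : ∀ X Y : 𝔸, τ (X * Y) = τ (Y * X))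
  (hφτ : ∀ X Y : 𝔸, ⟪φ.symm X, φ.symm Y⟫_ℂ = τ (star X * Y))
  (η : ℝ) (U : Bond d (towerP L m (n + 1)) → 𝔸ˣ) (hUst : ∀ b, star (U b : 𝔸) = (((U b)⁻¹ : 𝔸ˣ) : 𝔸))
  (a' : ℝ) (hpos' : ∀ x : SiteL2K ℂ d (towerP L m (n + 1)) c₀ W, x ≠ 0 → 0 < RCLike.re ⟪x, laplacePrimeAk L m n φ η U a' (c₁ := c₁) x⟫_ℂ)
  (hL : 1 ≤ L) (αU : ℕ → ℝ) (hα1 : ∀ j, αU j ≤ 1 / 64)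
  (hU1 : ∀ (j : ℕ) (x : B7Prop1Explicit.Site d) (κ : Fin d), perCfg (towerP L m (j + 1)) (UlevOf L m (n + 1) U j) x κ ∈ U1 𝔸)
  (hreg : ∀ (j : ℕ) (y : TSite d (towerP L m j)) (κ : Fin d) (r : Fin d → Fin L),
    ‖((Wcx L (perCfg (towerP L m (j + 1)) (UlevOf L m (n + 1) U j)) (cornerSite L y) κ (boxVec L r) : 𝔸ˣ) : 𝔸) - 1‖ ≤ αU j)
  (a : ℝ)
  (hposπ : ∀ x : BondL2K ℂ d (towerP L m (n + 1)) c₀ W, x ≠ 0 →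
    0 < RCLike.re ⟪x, laplaceAkPi L m n φ τ η U a' hpos' hL αU hα1 hU1 hreg (c₁ := c₁) a x⟫_ℂ)

include hτ₁ hτ₂ hφτ hUst

/-! ## §1 The left half of (3.152) for print's `G̃_k`: `R_kD*_UG̃_k = R_kG′_kD*_U` -/

/-- **`R_k(D*_U(G̃_kf)) = R_k(G′_k(D*_Uf))` — THE LEFT HALF OF (3.152) FOR PRINT's `G̃_k`**, the Hilbert adjoint of (T4E)'s `G̃_k(D_U(R_ks)) = D_U(G′_k(R_ks))`:
for every gauge parameter `s`, `⟪R_kD*_UG̃_kf, s⟫ = ⟪f, G̃_kD_UR_ks⟫ = ⟪f, D_UG′_kR_ks⟫ = ⟪R_kG′_kD*_Uf, s⟫` (`R_k`, `G̃_k`, `G′_k` symmetric; `D*_U = D_U†` at a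
unitary background with the tracial norming). [folklore] [cite: Balaban1985BackgroundPropagators, (3.152) p.426, (3.151) p.426, (3.21) p.394, (3.10) p.392] -/
theorem RofUk_covDivL2K_G1LatticeKPi (f : BondL2K ℂ d (towerP L m (n + 1)) c₀ W) :
    RofUk L m n φ η U (covDivL2K ℂ c₀ ((η : ℂ))⁻¹ (adTransportW φ fun bb => (U bb)⁻¹) (G1LatticeK hposπ f)) =
      RofUk L m n φ η U (GpOfUk L m n φ η U a' (c₁ := c₁) hpos' (covDivL2K ℂ c₀ ((η : ℂ))⁻¹ (adTransportW φ fun bb => (U bb)⁻¹) f)) := by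
  have hc : conj (((η : ℂ))⁻¹) = ((η : ℂ))⁻¹ := by rw [map_inv₀, Complex.conj_ofReal]
  have hRS := adTransportW_adjoint φ τ hτ₂ hUst hφτ
  have hadj : covDivL2K ℂ c₀ ((η : ℂ))⁻¹ (adTransportW φ fun bb => (U bb)⁻¹) =
      LinearMap.adjoint (covDerivL2K ℂ c₀ ((η : ℂ))⁻¹ (adTransportW φ U)) := (adjoint_covDerivL2K _ hc _ _ hRS).symm
  have hR := RofUk_isSymmetric L m n φ η U (c₀ := c₀)
  have hG : (G1LatticeK hposπ).IsSymmetric :=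
    greenK_isSymmetric hposπ (laplaceAkPi_isSymmetric L m n φ τ η U a' hpos' hL αU hα1 hU1 hreg hUst hτ₁ hτ₂ hφτ a)
  have hGp : (GpOfUk L m n φ η U a' (c₁ := c₁) hpos').IsSymmetric :=
    greenK_isSymmetric hpos' (laplacePrimeAk_isSymmetric L m n φ η U a' hRS)
  refine ext_inner_right ℂ fun s => ?_
  rw [hR, hadj, LinearMap.adjoint_inner_left, hG, G1LatticeKPi_covDerivL2K_RofUk L m n φ τ η U a' hpos' hL αU hα1 hU1 hreg a hposπ s,
    ← LinearMap.adjoint_inner_left, ← hGp, ← hR]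

/-! ## §2 The third word of `𝔊̃_k` is `D_UG′_kR_kG′_kD*_U` -/

/-- **THE THIRD WORD OF `𝔊̃_k` AS A PURE `G′_k`-WORD: `G̃_k(D_U(R_k(D*_U(G̃_kf)))) = D_U(G′_k(R_k(G′_k(D*_Uf))))`** — (T4E) §1 at `s := D*_U(G̃_kf)`, then §1;
print's `DG′RG′D*` of (3.150)∕(3.153). [folklore] [cite: Balaban1985BackgroundPropagators, (3.152)–(3.153) p.426, (3.150) p.426, (3.147) p.425] -/
theorem thirdWord_G1LatticeKPi_eq (f : BondL2K ℂ d (towerP L m (n + 1)) c₀ W) :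
    G1LatticeK hposπ (covDerivL2K ℂ c₀ ((η : ℂ))⁻¹ (adTransportW φ U) (RofUk L m n φ η U
      (covDivL2K ℂ c₀ ((η : ℂ))⁻¹ (adTransportW φ fun bb => (U bb)⁻¹) (G1LatticeK hposπ f)))) =
      covDerivL2K ℂ c₀ ((η : ℂ))⁻¹ (adTransportW φ U) (GpOfUk L m n φ η U a' (c₁ := c₁) hpos' (RofUk L m n φ η U
        (GpOfUk L m n φ η U a' (c₁ := c₁) hpos' (covDivL2K ℂ c₀ ((η : ℂ))⁻¹ (adTransportW φ fun bb => (U bb)⁻¹) f)))) := by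
  rw [G1LatticeKPi_covDerivL2K_RofUk L m n φ τ η U a' hpos' hL αU hα1 hU1 hreg a hposπ,
    RofUk_covDivL2K_G1LatticeKPi L m n φ τ hτ₁ hτ₂ hφτ η U hUst a' hpos' hL αU hα1 hU1 hreg a hposπ f]

/-- **The third word read on the plain bond functions** (the `WL2.equiv` form of the row files): pointwise the same identity. [folklore]
[cite: Balaban1985BackgroundPropagators, (3.152)–(3.153) p.426] -/
theorem thirdWord_G1LatticeKPi_eq_slice (f : BondL2K ℂ d (towerP L m (n + 1)) c₀ W) (b : Bond d (towerP L m (n + 1))) :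
    WL2.equiv ℂ (fun _ : Bond d (towerP L m (n + 1)) => c₀) W
        (G1LatticeK hposπ (covDerivL2K ℂ c₀ ((η : ℂ))⁻¹ (adTransportW φ U) (RofUk L m n φ η U
          (covDivL2K ℂ c₀ ((η : ℂ))⁻¹ (adTransportW φ fun bb => (U bb)⁻¹) (G1LatticeK hposπ f))))) b =
      WL2.equiv ℂ (fun _ : Bond d (towerP L m (n + 1)) => c₀) W
        (covDerivL2K ℂ c₀ ((η : ℂ))⁻¹ (adTransportW φ U) (GpOfUk L m n φ η U a' (c₁ := c₁) hpos' (RofUk L m n φ η U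
          (GpOfUk L m n φ η U a' (c₁ := c₁) hpos' (covDivL2K ℂ c₀ ((η : ℂ))⁻¹ (adTransportW φ fun bb => (U bb)⁻¹) f))))) b := by
  rw [thirdWord_G1LatticeKPi_eq L m n φ τ hτ₁ hτ₂ hφτ η U hUst a' hpos' hL αU hα1 hU1 hreg a hposπ f]

end Literature.MathematicalPhysics.QuantumFieldTheory.Balaban1983to89.B9Eq3152GtildeThirdWordTwoSided

end
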